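import Summits.Ventures.CertifiedArithmetic.Expansions.CompressAdjacencyInvariant
import Summits.Ventures.CertifiedArithmetic.Expansions.CompressValuationSteps
import Mathlib.Tactic.Linarith
import Mathlib.Tactic.Positivity
import Mathlib.Tactic.Ring
import Mathlib.Tactic.NormNum

/-!
# COMPRESS under any tie rule: the adjacency invariant holds from precision 3 on (new work)

New work of the certified-arithmetic venture (ENGINES group: shared numerical engines serving
client cells; rigour lives in the verifiers; every published number belongs to a client cell's
ledger, not to the engines group).  `CompressAdjacencyInvariant.lean` carries the adjacency
invariant `AdjInv` of the upward sweep of COMPRESS [Shewchuk1997, §2.7, Fig. 13 Lines 10–16]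
through one FAST-TWO-SUM step for every round-to-nearest map, at precision `p ≥ 4`: its key step
`below_two_emit_of_adjacent` closes with the magnitude estimate `|x| ≥ |g| − |Q| − |q| ≥
(2^(2p−2) − 2^(p−1) − 1)·2^u` against `|x| < 2^(p+1)·2^u`, which is contradictory only when
`2^(2p−2) − 2^(p−1) − 1 ≥ 2^(p+1)`, i.e. `p ≥ 4` (at `p = 3` it reads `11·2^u ≤ |x| < 16·2^u`).
THIS FILE proves the same key step, with the same hypotheses, for every `p ≥ 3`
(`below_two_emit_of_adjacent_three_le`) and hence the emitting step of the invariant for `p ≥ 3`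
(`AdjInv.emit_three_le`, the proof of `AdjInv.emit` verbatim with the new key step); the exact
step `AdjInv.absorb` already holds for `p ≥ 2`.  The sequel `CompressWeakExpansion.lean` runs
the sweep with these and obtains, for every round-to-nearest and every `p ≥ 3`, that no
component of `COMPRESS(e)` is adjacent to both neighbours and that the lower member of an
adjacent consecutive pair is one-bit.

MECHANISM (an exactness dichotomy in place of the magnitude estimate).  In the emitting step
`(x, q) = FAST-TWO-SUM(g, Q)` after an adjacent pair, the carry `Q` is normal on the grid `2^u`
(`|Q| ≥ 2^(p−1)·2^u`) and `|Q| ≤ ulp g`.  Either `ulp g ≥ 2^(u+p)`: then `|g + Q| ≥ |g| − ulp g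
≥ (2^(p−1) − 1)·ulp g ≥ 2·2^(u+p)` as soon as `2^(p−1) − 1 ≥ 2`, i.e. `p ≥ 3`, so the FLOAT
`2^(u+p+1)` lies below `|g + Q|` and monotonicity of rounding gives `|x| = |fl(g + Q)| ≥
2^(u+p+1)`, against `ulp x = 2^(u+1)`; or `ulp g ≤ 2^(u+p−1) ≤ |Q| ≤ ulp g`: then `|Q| = ulp g`,
so `g + Q = g ± ulp g` is itself a float (the tree's `isFloat_add_ulp_signed` of
`CompressValuationSteps.lean`), the step is exact and emits nothing.  HONEST FRAMING: nothing
here is claimed by the paper (Theorem 23's nonadjacency clause assumes round-to-even); `p = 2`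
stays excluded — there the key step is FALSE as stated (carry `Q = 6` on the grid `2^1` after
the roundoff `r = −1`, `g = −16`: ties-to-away gives `x = fl(−10) = −12`, `q = 2`, adjacent to
`r` and NOT 2-below `x`), and the venture's exhaustive data for `p = 2` rest on down-sweep
reachability, which the up-sweep invariant does not see.
-/

namespace Summit.Ventures.CertifiedArithmetic.Expansions

open Literature.ComputerArithmetic.JeannerodRump2018
open Literature.ComputerArithmetic.BoldoJeannerodMelquiondMuller2023 hiding twoSum twoSum_fst
open Literature.ComputerArithmetic.Shewchuk1997

variable {p : ℕ} {emin : ℤ} {fl : ℚ → ℚ}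

/-! ### The key step from precision 3 on -/

/-- **KEY STEP** (`p ≥ 3`; the hypotheses of `below_two_emit_of_adjacent` with `4 ≤ p` relaxed).
In a step `(x, q) = FAST-TWO-SUM(g, Q)` of the upward sweep with `q ≠ 0` (`g` a float,
`|g| ≥ 2^(emin+p)`, `|Q| ≤ ulp g`), the carry `Q` normal on a grid `2^u` (`OnGrid u Q`,
`2^(p−1)·2^u ≤ |Q|`) below which the previous roundoff `r` sits (`2|r| ≤ 2^u`): if `q` is
adjacent to `r` then `q` lies 2-below `x`.  As in the `p ≥ 4` proof, `2|q| = ulp x` would give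
`ulp x = 2^(u+1)`, `|x| < 2^(u+p+1)`; then EITHER `ulp g ≥ 2^(u+p)`, so the float `2^(u+p+1)`
lies below `|g + Q| ≥ (2^(p−1) − 1)·ulp g` (`p ≥ 3`) and hence below `|x| = |fl(g + Q)|`, OR
`|Q| = ulp g` and `g + Q` is a float, so `q = 0`.
[cite: Shewchuk1997, Thm 23 p. 333; BoldoEtAl2023, §2.1 (ulp), Def. 2.3 (monotonicity)] -/
theorem below_two_emit_of_adjacent_three_le (hp : 3 ≤ p) (hfl : IsRoundNearest p emin fl)
    {r Q g : ℚ} {u : ℤ} (hu : emin ≤ u) (huQ : OnGrid u Q) (hr : 2 * |r| ≤ (2 : ℚ) ^ u)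
    (hQbig : (2 : ℚ) ^ u * 2 ^ (p - 1) ≤ |Q|) (hQ : IsFloat p emin Q) (hg : IsFloat p emin g)
    (hgbig : (2 : ℚ) ^ (emin + p) ≤ |g|) (hQg : |Q| ≤ ulp p emin g)
    (hq : (fastTwoSum fl g Q).2 ≠ 0) (hadj : ¬ Below 2 r (fastTwoSum fl g Q).2) :
    Below 2 (fastTwoSum fl g Q).2 (fastTwoSum fl g Q).1 := by
  have hp1 : 1 ≤ p := by omega
  have hA : (0 : ℚ) < 2 ^ u := zpow_pos (by norm_num) _
  have hg0 : g ≠ 0 := abs_pos.mp ((zpow_pos two_pos _).trans_le hgbig)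
  have hQleg : |Q| ≤ |g| := hQg.trans (ulp_le_abs_of_isFloat hg hg0)
  obtain ⟨h1, -, h2, -⟩ := fastTwoSum_exact hp1 hfl hg hQ hQleg
  have hF12 := isFloat_fastTwoSum hfl g Q
  obtain ⟨-, hsq⟩ := onGrid_upStep hp1 hfl hg hQg hu huQ (two_zpow_le_of_normal hQbig)
  -- the step is inexact: `g + Q` is not a float
  have hnf : ¬ IsFloat p emin (g + Q) := fun hf =>
    hq (by rw [h2, fl_eq_self hfl hf, sub_self])
  have hq_half : |(fastTwoSum fl g Q).2| ≤ ulp p emin (g + Q) / 2 := by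
    rw [h2]; exact abs_sub_fl_le_half_ulp hp1 hfl _
  have hulp_t : ulp p emin (g + Q) ≤ ulp p emin (fastTwoSum fl g Q).1 := by
    rw [h1]; exact ulp_le_ulp_fl hp1 hfl _
  -- monotonicity of rounding: a float below `|g + Q|` is below `|x|`
  have hmono : ∀ f : ℚ, IsFloat p emin f → |f| ≤ |g + Q| → |f| ≤ |(fastTwoSum fl g Q).1| := by
    intro f hf hle
    rw [h1]; exact abs_le_abs_fl hfl hf hle
  generalize hQn : (fastTwoSum fl g Q).1 = Qn at *
  generalize hqn : (fastTwoSum fl g Q).2 = q at *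
  -- adjacency to `r`: `2|r| = 2^u` and `q` is not on the grid `2^(u+1)`
  have hr_eq : 2 * |r| = (2 : ℚ) ^ u := by
    by_contra hne
    exact hadj ⟨u, hsq, lt_of_le_of_ne hr hne⟩
  have hnot : ¬ OnGrid (u + 1) q := fun h' =>
    hadj ⟨u + 1, h', by rw [hr_eq, zpow_add_one₀ two_ne_zero]; linarith⟩
  -- the grid of the new carry
  obtain ⟨w, -, hW⟩ := exists_ulp_eq_two_zpow (p := p) (emin := emin) Qn
  have hwQn : OnGrid w Qn := by
    obtain ⟨K, hK⟩ := exists_eq_int_mul_ulp_of_isFloat (p := p) (emin := emin) hF12.1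
    exact ⟨K, by rw [← hW]; exact hK⟩
  refine ⟨w, hwQn, lt_of_le_of_ne (by rw [← hW]; linarith) fun heq => ?_⟩
  -- suppose `2|q| = 2^w = ulp Qn`: then `|q| = 2^(w-1)` and `w = u + 1`
  have hq_abs : |q| = (2 : ℚ) ^ (w - 1) := by
    rw [zpow_sub_one₀ two_ne_zero]; linarith
  have hq_grid : OnGrid (w - 1) q := by
    rcases (abs_eq (zpow_nonneg (by norm_num) (w - 1))).mp hq_abs with h | h
    · exact ⟨1, by rw [h]; simp⟩
    · exact ⟨-1, by rw [h]; simp⟩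
  have hu_le : u ≤ w - 1 := by
    have := hsq.two_zpow_le_abs hq
    rw [hq_abs] at this
    exact (zpow_le_zpow_iff_right₀ (by norm_num : (1 : ℚ) < 2)).mp this
  have hu_ge : w - 1 ≤ u := by
    by_contra hlt
    exact hnot (hq_grid.mono (by omega))
  have hwu : w = u + 1 := by omega
  -- so `|Qn| < 2^p·2^w = 2^(u+p+1)`
  have hQn_lt : |Qn| < 2 ^ p * (2 : ℚ) ^ w := by rw [← hW]; exact abs_lt_two_pow_mul_ulp Qn
  have h2pw : (2 : ℚ) ^ p * 2 ^ w = 2 ^ (u + p + 1) := by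
    rw [hwu, ← zpow_natCast, ← zpow_add₀ two_ne_zero]; congr 1; ring
  rw [h2pw] at hQn_lt
  -- the grid `2^v = ulp g` of `g`, and the dichotomy
  obtain ⟨v, hv, hV⟩ := exists_ulp_eq_two_zpow (p := p) (emin := emin) g
  have hB : (0 : ℚ) < 2 ^ v := zpow_pos (by norm_num) _
  rcases le_or_gt (u + p) v with hle | hlt
  · -- `ulp g ≥ 2^(u+p)`: the float `2^(u+p+1)` lies below `|g + Q|`, hence below `|Qn|`
    have hn : (2 : ℚ) ^ (emin + p - 1) ≤ |g| :=
      le_trans (zpow_le_zpow_right₀ (by norm_num) (by omega)) hgbig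
    have hU : ulp p emin g * 2 ^ (p - 1) ≤ |g| :=
      (le_div_iff₀ (by positivity)).mp (ulp_le_of_normal hp1 hn)
    rw [hV] at hU hQg
    have hP4 : (4 : ℚ) ≤ 2 ^ (p - 1) :=
      calc (4 : ℚ) = 2 ^ 2 := by norm_num
        _ ≤ 2 ^ (p - 1) := pow_le_pow_right₀ (by norm_num) (by omega)
    have h4v : (2 : ℚ) ^ v * 4 ≤ 2 ^ v * 2 ^ (p - 1) := mul_le_mul_of_nonneg_left hP4 hB.le
    have hgQ : |g| - |Q| ≤ |g + Q| := by
      have := abs_sub_abs_le_abs_sub g (-Q)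
      rwa [abs_neg, sub_neg_eq_add] at this
    have h2v : (2 : ℚ) ^ (u + p + 1) ≤ 2 * 2 ^ v := by
      rw [show u + (p : ℤ) + 1 = (u + p) + 1 by ring, zpow_add_one₀ two_ne_zero, mul_comm]
      exact mul_le_mul_of_nonneg_left (zpow_le_zpow_right₀ (by norm_num) hle) (by norm_num)
    have hf : IsFloat p emin ((2 : ℚ) ^ (u + p + 1)) :=
      ⟨1, u + p + 1, by rw [abs_one]; exact_mod_cast Nat.one_lt_two_pow (by omega),
        by omega, by simp⟩
    have hfle : |(2 : ℚ) ^ (u + p + 1)| ≤ |g + Q| := by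
      rw [abs_of_pos (zpow_pos (by norm_num) _)]; linarith
    have hx := hmono _ hf hfle
    rw [abs_of_pos (zpow_pos (by norm_num) _)] at hx
    linarith
  · -- `ulp g ≤ 2^(u+p−1) ≤ |Q| ≤ ulp g`: `|Q| = ulp g`, so `g + Q` is a float
    have hQv : (2 : ℚ) ^ v ≤ |Q| :=
      calc (2 : ℚ) ^ v ≤ 2 ^ (u + ((p - 1 : ℕ) : ℤ)) :=
            zpow_le_zpow_right₀ (by norm_num) (by omega)
        _ = 2 ^ u * 2 ^ (p - 1) := by rw [zpow_add₀ two_ne_zero, zpow_natCast]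
        _ ≤ |Q| := hQbig
    rw [hV] at hQg
    obtain ⟨hplus, hminus⟩ := isFloat_add_ulp_signed hp1 hg hV hv
    rcases (abs_eq hB.le).mp (le_antisymm hQg hQv) with h | h
    · exact hnf (by rw [h]; exact hplus)
    · exact hnf (by rw [h, ← sub_eq_add_neg]; exact hminus)

/-! ### The emitting step of the adjacency invariant from precision 3 on -/

/-- EMITTING STEP (`q ≠ 0`, `p ≥ 3`): the roundoff `q` is emitted and the carry becomes
`x = fl(g + Q)`; `AdjInv` is carried exactly as in `AdjInv.emit` (window by the flag, pair by
the old head record, new head record on the grid `ulp(g + Q)` with `g + Q` normal), the new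
flag now by `below_two_emit_of_adjacent_three_le`.  The proof is that of `AdjInv.emit` with the
key step exchanged. [cite: Shewchuk1997, Thm 23 p. 333; BoldoEtAl2023, §2.1] -/
theorem AdjInv.emit_three_le (hp : 3 ≤ p) (hfl : IsRoundNearest p emin fl) {rs : List ℚ}
    {Q g : ℚ} (ainv : AdjInv p emin rs Q) (inv : UpInv p emin 1 rs Q) (hg : IsFloat p emin g)
    (hgbig : (2 : ℚ) ^ (emin + p) ≤ |g|) (hQg : |Q| ≤ ulp p emin g)
    (hq : (fastTwoSum fl g Q).2 ≠ 0) :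
    AdjInv p emin ((fastTwoSum fl g Q).2 :: rs) (fastTwoSum fl g Q).1 := by
  have hp1 : 1 ≤ p := by omega
  have hg0 : g ≠ 0 := abs_pos.mp ((zpow_pos two_pos _).trans_le hgbig)
  have hQleg : |Q| ≤ |g| := hQg.trans (ulp_le_abs_of_isFloat hg hg0)
  obtain ⟨h1, -, h2, -⟩ := fastTwoSum_exact hp1 hfl hg inv.hQ hQleg
  -- a `Below 2 · Q` relation of the current head transfers to the emitted roundoff
  have hconv : ∀ r ∈ rs.head?, Below 2 r Q → Below 2 r (fastTwoSum fl g Q).2 := by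
    intro r hr hb
    obtain ⟨s, hs, hsQ, hrs, h2s⟩ := below_two_grid hb inv.hQ (inv.hd r hr).2
    exact ⟨s, (onGrid_upStep hp1 hfl hg hQg hs hsQ h2s).2, hrs⟩
  -- the new head record, on the grid `2^k = ulp(g + Q)`
  have hhd : ∃ u : ℤ, emin ≤ u ∧ OnGrid u (fastTwoSum fl g Q).1 ∧
      2 * |(fastTwoSum fl g Q).2| ≤ (2 : ℚ) ^ u ∧
      (2 : ℚ) ^ u * 2 ^ (p - 1) ≤ |(fastTwoSum fl g Q).1| := by
    obtain ⟨k, hk, hK⟩ := exists_ulp_eq_two_zpow (p := p) (emin := emin) (g + Q)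
    refine ⟨k, hk, ?_, ?_, ?_⟩
    · obtain ⟨K, hK'⟩ := exists_fl_eq_int_mul_ulp hp1 hfl (g + Q)
      exact ⟨K, by rw [h1, hK', hK]⟩
    · rw [h2, ← hK]; linarith [abs_sub_fl_le_half_ulp hp1 hfl (g + Q)]
    · have hgQ : |g| - |Q| ≤ |g + Q| := by
        have := abs_sub_abs_le_abs_sub g (-Q)
        rwa [abs_neg, sub_neg_eq_add] at this
      have hg2 : (2 : ℚ) ^ (emin + p - 1) * 2 ≤ |g| := by
        rw [← zpow_add_one₀ two_ne_zero, show emin + p - 1 + 1 = emin + (p : ℤ) by ring]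
        exact hgbig
      have hn' : (2 : ℚ) ^ (emin + p - 1) ≤ |g| := by
        linarith [zpow_pos (by norm_num : (0 : ℚ) < 2) (emin + p - 1)]
      have hUg : ulp p emin g * 2 ^ (p - 1) ≤ |g| :=
        (le_div_iff₀ (by positivity)).mp (ulp_le_of_normal hp1 hn')
      have hP2 : (2 : ℚ) ≤ 2 ^ (p - 1) :=
        calc (2 : ℚ) = 2 ^ 1 := by norm_num
          _ ≤ 2 ^ (p - 1) := pow_le_pow_right₀ (by norm_num) (by omega)
      have hn : (2 : ℚ) ^ (emin + p - 1) ≤ |g + Q| := by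
        nlinarith [ulp_pos (p := p) (emin := emin) g]
      have hU : ulp p emin (g + Q) * 2 ^ (p - 1) ≤ |g + Q| :=
        (le_div_iff₀ (by positivity)).mp (ulp_le_of_normal hp1 hn)
      have hf : IsFloat p emin (ulp p emin (g + Q) * 2 ^ (p - 1)) := by
        rw [hK, ← zpow_natCast, ← zpow_add₀ two_ne_zero]
        exact ⟨1, k + ((p - 1 : ℕ) : ℤ),
          by rw [abs_one]; exact_mod_cast Nat.one_lt_two_pow (by omega), by omega, by simp⟩
      have hpos : 0 < ulp p emin (g + Q) * 2 ^ (p - 1) := by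
        have := ulp_pos (p := p) (emin := emin) (g + Q); positivity
      have key := abs_le_abs_fl hfl hf (t := g + Q) (by rw [abs_of_pos hpos]; exact hU)
      rw [abs_of_pos hpos, hK] at key
      rw [h1]; exact key
  refine ⟨?_, List.isChain_cons.mpr ⟨fun r hr => ?_, ainv.low⟩, ?_, ?_⟩
  · refine ainv.win.cons fun b c t hrs => ?_
    by_cases hbc : Below 2 c b
    · exact Or.inl hbc
    · exact Or.inr (hconv b (by rw [hrs]; rfl) (ainv.flag b c t hrs hbc))
  · obtain ⟨u, hu, huQ, hr2, hQbig⟩ := ainv.hd r hr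
    exact lowOneBit_of_onGrid
      (onGrid_upStep hp1 hfl hg hQg hu huQ (two_zpow_le_of_normal hQbig)).2 hr2
  · intro r hr
    simp only [List.head?_cons, Option.mem_def, Option.some.injEq] at hr
    subst hr
    exact hhd
  · intro r₁ r₀ t heq hadj
    simp only [List.cons.injEq] at heq
    obtain ⟨rfl, hrs⟩ := heq
    obtain ⟨u, hu, huQ, hr, hQbig⟩ := ainv.hd r₀ (by rw [hrs]; rfl)
    exact below_two_emit_of_adjacent_three_le hp hfl hu huQ hr hQbig inv.hQ hg hgbig hQg hq hadj

end Summit.Ventures.CertifiedArithmetic.Expansions
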